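import Summits.ValiantsHypothesis.ValiantsHypothesis.Theorems.BarrierLeverTorusIsolatedDeterminantsHitByVP

/-!
# Route BarrierLever — item `ReadOnceDeterminantsHitByVP` (stmt-ValiantsHypothesis-20152), part 1/2:
# the degree-isolation lemma and BOX PRODUCT STATES

Helper file (`--supports stmt-ValiantsHypothesis-20152`; cell valiant-natproofs, rung V4, 𝒟-side,
prover seat val-np-p3). Definition-free. Closes NO item.

* `det_ne_zero_of_unique_maxDegree` (Mathlib only): a square matrix over `ℂ[X]` has nonzero
  determinant as soon as ONE permutation `σ₀` meets only nonzero entries and every other permutation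
  meets a zero entry or has a strictly smaller sum of entry degrees (the coefficient of
  `X^{Σ_j deg M (σ₀ j) j}` in `det M` is `± ∏_j leadingCoeff`).
* BOX PRODUCT STATES in `MvPolynomial (Fin n) ℂ`: `g_T = ∏_i Σ_{e ≤ d_i} T^{φ_i(e)} x_i^e`
  (box `d : Fin n → ℕ`, tables `φ_i : ℕ → ℕ`, parameter `T ∈ ℂ`); `coeff_boxState`:
  `coeff_m g_T = T^{Σ_i φ_i(m_i)}` for `m` in the box, `0` outside; `coeff_sumBoxStates` for a sum of
  `m` such states; `sumBoxStates_mem_smallCircuits`: degree `≤ n` (when `Σ_i d_{k,i} ≤ n`) and size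
  `≤ m·(n(n+1)(n+2)+n+1)`, hence in `SmallCircuits ℂ n (c+4)` for `m ≤ n^c`, `n ≥ 8`.

Part 2 (`…ReadOnceDeterminantsHitByVPMaxPlus`) evaluates determinantal layouts along this family.

WHAT THIS IS NOT: nothing item-specific is proved here.

References: Klivans–Spielman 2001 / Mulmuley–Vazirani–Vazirani 1987 (isolating one Leibniz term);
[Burgisser2000] §2.1 (size measure: variables and constants free, one gate per `+`/`×`).
-/

-- layout Summits/ValiantsHypothesis/ValiantsHypothesis forces the duplicated namespace component
set_option linter.dupNamespace false

namespace Summit.ValiantsHypothesis.ValiantsHypothesis.Theorems.BarrierLever.ReadOnceMaxPlus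

open Finset Literature.Barriers.ValiantsHypothesis Literature.Computability.AlgebraicComplexity

noncomputable section

/-! ## 1. The tropical lemma over `ℂ[X]` -/

section Tropical

open Polynomial

/-- **Unique permutation of maximal degree ⇒ nonzero determinant.** If `σ₀` meets only nonzero
entries of `M ∈ ℂ[X]^{r×r}` and every other permutation meets a zero entry or has a strictly smaller
sum of entry degrees, then `det M ≠ 0` (the coefficient of `X^{Σ_j deg M (σ₀ j) j}` is
`± ∏_j leadingCoeff ≠ 0`). -/
theorem det_ne_zero_of_unique_maxDegree {r : ℕ} (M : Matrix (Fin r) (Fin r) ℂ[X])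
    (σ₀ : Equiv.Perm (Fin r)) (h0 : ∀ j, M (σ₀ j) j ≠ 0)
    (huniq : ∀ σ : Equiv.Perm (Fin r), σ ≠ σ₀ →
      (∃ j, M (σ j) j = 0) ∨ ∑ j, (M (σ j) j).natDegree < ∑ j, (M (σ₀ j) j).natDegree) :
    M.det ≠ 0 := by
  set N : ℕ := ∑ j, (M (σ₀ j) j).natDegree with hN
  have hfac : ∀ j ∈ (univ : Finset (Fin r)), M (σ₀ j) j ≠ 0 := fun j _ => h0 j
  have hP0 : (∏ j, M (σ₀ j) j).coeff N ≠ 0 := by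
    have hdeg : (∏ j, M (σ₀ j) j).natDegree = N := natDegree_prod _ _ hfac
    rw [← hdeg, coeff_natDegree, leadingCoeff_ne_zero]
    exact Finset.prod_ne_zero_iff.mpr hfac
  have hPσ : ∀ σ : Equiv.Perm (Fin r), σ ≠ σ₀ → (∏ j, M (σ j) j).coeff N = 0 := by
    intro σ hσ
    rcases huniq σ hσ with ⟨j, hj⟩ | hlt
    · rw [Finset.prod_eq_zero (f := fun j => M (σ j) j) (mem_univ j) hj, coeff_zero]
    · exact coeff_eq_zero_of_natDegree_lt ((natDegree_prod_le _ _).trans_lt hlt)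
  have hterm : ∀ σ : Equiv.Perm (Fin r),
      ((((Equiv.Perm.sign σ : ℤˣ) : ℤ) : ℂ[X]) * ∏ j, M (σ j) j).coeff N =
        (((Equiv.Perm.sign σ : ℤˣ) : ℤ) : ℂ) * (∏ j, M (σ j) j).coeff N := by
    intro σ
    rw [← C_eq_intCast, coeff_C_mul]
  intro hdet
  have hcoeff : (M.det).coeff N = 0 := by rw [hdet, coeff_zero]
  rw [Matrix.det_apply', finsetSum_coeff, Finset.sum_eq_single σ₀, hterm] at hcoeff
  · exact mul_ne_zero (Int.cast_ne_zero.mpr (Units.ne_zero _)) hP0 hcoeff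
  · intro σ _ hσ
    rw [hterm, hPσ σ hσ, mul_zero]
  · intro h; exact absurd (mem_univ σ₀) h

/-- Degree of a sum of powers of `X` over a finite set: at most the maximal exponent. -/
theorem natDegree_finsetSum_X_pow_le {ι : Type*} (S : Finset ι) (e : ι → ℕ) :
    (∑ k ∈ S, (X : ℂ[X]) ^ e k).natDegree ≤ S.sup e := by
  apply natDegree_sum_le_of_forall_le
  intro k hk
  rw [natDegree_X_pow]
  exact Finset.le_sup hk

/-- For a NONEMPTY index set the coefficient at the maximal exponent is a positive integer. -/
theorem coeff_finsetSum_X_pow_sup_ne_zero {ι : Type*} [DecidableEq ι] (S : Finset ι)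
    (hS : S.Nonempty) (e : ι → ℕ) : (∑ k ∈ S, (X : ℂ[X]) ^ e k).coeff (S.sup e) ≠ 0 := by
  rw [finsetSum_coeff]
  simp only [coeff_X_pow]
  rw [Finset.sum_boole, Nat.cast_ne_zero, ← Nat.pos_iff_ne_zero, Finset.card_pos]
  obtain ⟨k, hk, hk'⟩ := Finset.exists_mem_eq_sup S hS e
  exact ⟨k, by simp [hk, hk']⟩

/-- For a nonempty index set, `Σ_{k ∈ S} X^{e k}` has degree exactly `max_{k ∈ S} e k`. -/
theorem natDegree_finsetSum_X_pow {ι : Type*} [DecidableEq ι] (S : Finset ι) (hS : S.Nonempty)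
    (e : ι → ℕ) : (∑ k ∈ S, (X : ℂ[X]) ^ e k).natDegree = S.sup e :=
  le_antisymm (natDegree_finsetSum_X_pow_le S e)
    (le_natDegree_of_ne_zero (coeff_finsetSum_X_pow_sup_ne_zero S hS e))

/-- For a nonempty index set, `Σ_{k ∈ S} X^{e k} ≠ 0`. -/
theorem finsetSum_X_pow_ne_zero {ι : Type*} [DecidableEq ι] (S : Finset ι) (hS : S.Nonempty)
    (e : ι → ℕ) : (∑ k ∈ S, (X : ℂ[X]) ^ e k) ≠ 0 := by
  intro h0
  have := coeff_finsetSum_X_pow_sup_ne_zero S hS e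
  rw [h0, coeff_zero] at this
  exact this rfl

end Tropical

/-! ## 2. Box product states and their coefficients -/

section BoxStates

open MvPolynomial

variable {n : ℕ}

/-- A univariate factor `Σ_{e ≤ d} T^{φ e} x_i^e` as a sum of monomials. -/
theorem boxFactor_eq_sum_monomial (T : ℂ) (i : Fin n) (d : ℕ) (φ : ℕ → ℕ) :
    (∑ e ∈ range (d + 1), C (T ^ φ e) * X i ^ e : MvPolynomial (Fin n) ℂ) =
      ∑ e ∈ range (d + 1), monomial (Finsupp.single i e) (T ^ φ e) := by
  refine Finset.sum_congr rfl fun e _ => ?_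
  rw [X_pow_eq_monomial, C_mul_monomial, mul_one]

/-- A box product state expanded: one monomial per lattice point `g` of the box. -/
theorem boxState_eq_sum_monomial (T : ℂ) (d : Fin n → ℕ) (φ : Fin n → ℕ → ℕ) :
    (∏ i, ∑ e ∈ range (d i + 1), C (T ^ φ i e) * X i ^ e : MvPolynomial (Fin n) ℂ) =
      ∑ g ∈ Fintype.piFinset (fun i => range (d i + 1)),
        monomial (∑ i, Finsupp.single i (g i)) (∏ i, T ^ φ i (g i)) := by
  simp_rw [boxFactor_eq_sum_monomial]
  rw [Finset.prod_univ_sum]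
  refine Finset.sum_congr rfl fun g _ => ?_
  rw [monomial_sum_prod]

/-- `Σ_i single i (g i)` is the finitely supported function `g`. -/
theorem sum_single_apply (g : Fin n → ℕ) (i : Fin n) :
    (∑ i', Finsupp.single i' (g i') : Fin n →₀ ℕ) i = g i := by
  rw [Finsupp.finsetSum_apply]
  simp only [Finsupp.single_apply]
  rw [Finset.sum_ite_eq' univ i]
  simp

/-- `Σ_i single i (g i) = m` iff `g = ⇑m`. -/
theorem sum_single_eq_iff (g : Fin n → ℕ) (m : Fin n →₀ ℕ) :
    (∑ i', Finsupp.single i' (g i') : Fin n →₀ ℕ) = m ↔ g = ⇑m := by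
  constructor
  · intro hg
    funext i
    have := congrArg (fun v => v i) hg
    simpa only [sum_single_apply] using this
  · rintro rfl
    ext i
    exact sum_single_apply _ _

/-- **Coefficients of a box product state**: `coeff_m (∏_i Σ_{e ≤ d_i} T^{φ_i e} x_i^e)` is
`T^{Σ_i φ_i(m_i)}` if `m` lies in the box `∏_i [0, d_i]` and `0` otherwise. -/
theorem coeff_boxState (T : ℂ) (d : Fin n → ℕ) (φ : Fin n → ℕ → ℕ) (m : Fin n →₀ ℕ) :
    coeff m (∏ i, ∑ e ∈ range (d i + 1), C (T ^ φ i e) * X i ^ e : MvPolynomial (Fin n) ℂ) =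
      if ∀ i, m i ≤ d i then T ^ ∑ i, φ i (m i) else 0 := by
  rw [boxState_eq_sum_monomial, coeff_sum]
  simp_rw [coeff_monomial, sum_single_eq_iff]
  rw [Finset.sum_ite_eq' (Fintype.piFinset fun i => range (d i + 1)) (⇑m)]
  have hmem : (⇑m ∈ Fintype.piFinset fun i => range (d i + 1)) ↔ ∀ i, m i ≤ d i := by
    rw [Fintype.mem_piFinset]
    exact forall_congr' fun i => by rw [Finset.mem_range, Nat.lt_succ_iff]
  by_cases hbox : ∀ i, m i ≤ d i
  · rw [if_pos (hmem.mpr hbox), if_pos hbox, Finset.prod_pow_eq_pow_sum]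
  · rw [if_neg (fun h' => hbox (hmem.mp h')), if_neg hbox]

/-- **Coefficients of a sum of box product states**: the sum, over the experts whose box contains
`m`, of `T^{score}`. -/
theorem coeff_sumBoxStates (T : ℂ) {m : ℕ} (d : Fin m → Fin n → ℕ) (φ : Fin m → Fin n → ℕ → ℕ)
    (mo : Fin n →₀ ℕ) :
    coeff mo (∑ k, ∏ i, ∑ e ∈ range (d k i + 1), C (T ^ φ k i e) * X i ^ e :
        MvPolynomial (Fin n) ℂ) =
      ∑ k ∈ univ.filter (fun k => ∀ i, mo i ≤ d k i), T ^ ∑ i, φ k i (mo i) := by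
  rw [coeff_sum, Finset.sum_filter]
  exact Finset.sum_congr rfl fun k _ => coeff_boxState T (d k) (φ k) mo

/-! ### Degree and size -/

/-- A univariate factor with exponents `≤ d` has degree `≤ d`. -/
theorem totalDegree_boxFactor_le (T : ℂ) (i : Fin n) (d : ℕ) (φ : ℕ → ℕ) :
    (∑ e ∈ range (d + 1), C (T ^ φ e) * X i ^ e : MvPolynomial (Fin n) ℂ).totalDegree ≤ d := by
  refine (totalDegree_finsetSum _ _).trans (Finset.sup_le fun e he => ?_)
  rw [Finset.mem_range, Nat.lt_succ_iff] at he
  calc (C (T ^ φ e) * X i ^ e : MvPolynomial (Fin n) ℂ).totalDegree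
      ≤ (C (T ^ φ e) : MvPolynomial (Fin n) ℂ).totalDegree +
          (X i ^ e : MvPolynomial (Fin n) ℂ).totalDegree := totalDegree_mul _ _
    _ ≤ 0 + e := by
        gcongr
        · exact (totalDegree_C _).le
        · exact (totalDegree_pow _ _).trans (by rw [totalDegree_X]; simp)
    _ ≤ d := by simpa using he

/-- A box product state has degree `≤ Σ_i d_i`. -/
theorem totalDegree_boxState_le (T : ℂ) (d : Fin n → ℕ) (φ : Fin n → ℕ → ℕ) :
    (∏ i, ∑ e ∈ range (d i + 1), C (T ^ φ i e) * X i ^ e :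
      MvPolynomial (Fin n) ℂ).totalDegree ≤ ∑ i, d i :=
  (totalDegree_finsetProd _ _).trans (Finset.sum_le_sum fun i _ => totalDegree_boxFactor_le T i _ _)

/-- Powers of a variable: `L(x_i^e) ≤ e`. -/
theorem complexity_X_pow_le (i : Fin n) (e : ℕ) :
    complexity (X i ^ e : MvPolynomial (Fin n) ℂ) ≤ e := by
  induction e with
  | zero => rw [pow_zero, ← C_1]; exact (complexity_C_holds _).le
  | succ e ih =>
    rw [pow_succ]
    calc complexity (X i ^ e * X i : MvPolynomial (Fin n) ℂ)
        ≤ complexity (X i ^ e : MvPolynomial (Fin n) ℂ) +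
            complexity (X i : MvPolynomial (Fin n) ℂ) + 1 := complexity_mul_le_holds _ _
      _ ≤ e + 0 + 1 := by gcongr; exact (complexity_X_holds _).le

/-- A univariate factor with exponents `≤ d` has size `≤ (d+1)² + (d+1)`. -/
theorem complexity_boxFactor_le (T : ℂ) (i : Fin n) (d : ℕ) (φ : ℕ → ℕ) :
    complexity (∑ e ∈ range (d + 1), C (T ^ φ e) * X i ^ e : MvPolynomial (Fin n) ℂ) ≤
      (d + 1) * (d + 1) + (d + 1) := by
  have hterm : ∀ e ∈ range (d + 1),
      complexity (C (T ^ φ e) * X i ^ e : MvPolynomial (Fin n) ℂ) ≤ d + 1 := by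
    intro e he
    rw [Finset.mem_range, Nat.lt_succ_iff] at he
    calc complexity (C (T ^ φ e) * X i ^ e : MvPolynomial (Fin n) ℂ)
        ≤ complexity (C (T ^ φ e) : MvPolynomial (Fin n) ℂ) +
            complexity (X i ^ e : MvPolynomial (Fin n) ℂ) + 1 := complexity_mul_le_holds _ _
      _ ≤ 0 + e + 1 := by
          gcongr
          · exact (complexity_C_holds _).le
          · exact complexity_X_pow_le i e
      _ ≤ d + 1 := by omega
  calc complexity (∑ e ∈ range (d + 1), C (T ^ φ e) * X i ^ e : MvPolynomial (Fin n) ℂ)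
      ≤ ∑ e ∈ range (d + 1), complexity (C (T ^ φ e) * X i ^ e : MvPolynomial (Fin n) ℂ) +
          (range (d + 1)).card := complexity_finset_sum_le _ _
    _ ≤ ∑ _e ∈ range (d + 1), (d + 1) + (range (d + 1)).card := by
        gcongr with e he; exact hterm e he
    _ = (d + 1) * (d + 1) + (d + 1) := by simp

/-- A box product state with box sides `≤ n` has size `≤ n((n+1)² + (n+1)) + n`. -/
theorem complexity_boxState_le (T : ℂ) (d : Fin n → ℕ) (hd : ∀ i, d i ≤ n) (φ : Fin n → ℕ → ℕ) :
    complexity (∏ i, ∑ e ∈ range (d i + 1), C (T ^ φ i e) * X i ^ e : MvPolynomial (Fin n) ℂ) ≤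
      n * ((n + 1) * (n + 1) + (n + 1)) + n := by
  calc complexity (∏ i, ∑ e ∈ range (d i + 1), C (T ^ φ i e) * X i ^ e : MvPolynomial (Fin n) ℂ)
      ≤ ∑ i, complexity (∑ e ∈ range (d i + 1), C (T ^ φ i e) * X i ^ e : MvPolynomial (Fin n) ℂ) +
          (univ : Finset (Fin n)).card := complexity_finset_prod_le _ _
    _ ≤ ∑ i : Fin n, ((d i + 1) * (d i + 1) + (d i + 1)) + (univ : Finset (Fin n)).card := by
        gcongr with i _; exact complexity_boxFactor_le T i (d i) (φ i)
    _ ≤ ∑ _i : Fin n, ((n + 1) * (n + 1) + (n + 1)) + (univ : Finset (Fin n)).card := by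
        gcongr with i _ <;> exact hd i
    _ = n * ((n + 1) * (n + 1) + (n + 1)) + n := by simp

/-- A sum of `m` box product states with box sides `≤ n` has size `≤ m (n((n+1)²+(n+1)) + n) + m`. -/
theorem complexity_sumBoxStates_le (T : ℂ) {m : ℕ} (d : Fin m → Fin n → ℕ)
    (hd : ∀ k i, d k i ≤ n) (φ : Fin m → Fin n → ℕ → ℕ) :
    complexity (∑ k, ∏ i, ∑ e ∈ range (d k i + 1), C (T ^ φ k i e) * X i ^ e :
        MvPolynomial (Fin n) ℂ) ≤ m * (n * ((n + 1) * (n + 1) + (n + 1)) + n) + m := by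
  calc complexity (∑ k, ∏ i, ∑ e ∈ range (d k i + 1), C (T ^ φ k i e) * X i ^ e :
          MvPolynomial (Fin n) ℂ)
      ≤ ∑ k, complexity (∏ i, ∑ e ∈ range (d k i + 1), C (T ^ φ k i e) * X i ^ e :
          MvPolynomial (Fin n) ℂ) + (univ : Finset (Fin m)).card := complexity_finset_sum_le _ _
    _ ≤ ∑ _k : Fin m, (n * ((n + 1) * (n + 1) + (n + 1)) + n) + (univ : Finset (Fin m)).card := by
        gcongr with k _; exact complexity_boxState_le T (d k) (hd k) (φ k)
    _ = m * (n * ((n + 1) * (n + 1) + (n + 1)) + n) + m := by simp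

/-- **Membership**: `m ≤ n^c` box product states with `Σ_i d_{k,i} ≤ n` give a witness in
`SmallCircuits ℂ n (c+4)` for `n ≥ 8`. -/
theorem sumBoxStates_mem_smallCircuits (T : ℂ) {m c : ℕ} (hn : 8 ≤ n) (hm : m ≤ n ^ c)
    (d : Fin m → Fin n → ℕ) (hd : ∀ k, ∑ i, d k i ≤ n) (φ : Fin m → Fin n → ℕ → ℕ) :
    (∑ k, ∏ i, ∑ e ∈ range (d k i + 1), C (T ^ φ k i e) * X i ^ e : MvPolynomial (Fin n) ℂ) ∈
      SmallCircuits ℂ n (c + 4) := by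
  have hd' : ∀ k i, d k i ≤ n := fun k i =>
    (Finset.single_le_sum (fun j _ => Nat.zero_le (d k j)) (mem_univ i)).trans (hd k)
  refine ⟨(totalDegree_finsetSum _ _).trans (Finset.sup_le fun k _ =>
    (totalDegree_boxState_le T (d k) (φ k)).trans (hd k)), ?_⟩
  refine (complexity_sumBoxStates_le T d hd' φ).trans ?_
  have h8 : n * ((n + 1) * (n + 1) + (n + 1)) + n + 1 ≤ 8 * n ^ 3 := by nlinarith
  calc m * (n * ((n + 1) * (n + 1) + (n + 1)) + n) + m
      = m * (n * ((n + 1) * (n + 1) + (n + 1)) + n + 1) := by ring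
    _ ≤ n ^ c * (8 * n ^ 3) := by gcongr
    _ ≤ n ^ c * (n * n ^ 3) := by gcongr
    _ = n ^ (c + 4) := by ring

end BoxStates

end

end Summit.ValiantsHypothesis.ValiantsHypothesis.Theorems.BarrierLever.ReadOnceMaxPlus
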